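import Mathlib
import Summits.ValiantsHypothesis.ValiantsHypothesis.Theorems.KPlusLogSqLawTridiagonalRealStaticEdgeNormalForm
import Summits.ValiantsHypothesis.ValiantsHypothesis.Theorems.LacunarySymmetroidMatrixDescartesDoorA26WallBubblingExpNewtonChord

/-!
# ENS on the α register: Descartes–Fibonacci sharpness forces the gap-product (face) inequalities

Kernel form of §3(i) of this seat's memo `ENS-FACES-liftp2g17.md` (evidence on stmt-ValiantsHypothesis-19561): for a static symmetric
tridiagonal monomial design `(a, d, b, f)` with `a_j ≠ 0`, `b_j ≠ 0` whose matching SLOPE-SUMS `σ_M = ∑_{j∈M} L_j`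
(`L_j = 2f_j − d_j − d_{j+1}`) are injective on the matchings of the path (the Fibonacci regime: `D_m` has `F_{m+1}` exponent classes),
DESCARTES–FIBONACCI SHARPNESS — `#matchings − 1` distinct positive roots of `D_m` — forces, on every exponent PARALLELOGRAM of matchings
`σ_{M₀} + σ_{M₃} = σ_{M₁} + σ_{M₂}` (`σ_{M₀} < σ_{M₁} ≤ σ_{M₂} < σ_{M₃}`) whose coefficient moduli balance (`q^{M₀} q^{M₃} = q^{M₁} q^{M₂}`,
`q_j = b_j²/|a_j a_{j+1}|` — automatic on the faces `A, A+k, A+l, A+k+l`), the PARAMETER-FREE gap-product inequality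
`W_{M₀} W_{M₃} ≤ W_{M₁} W_{M₂}`, `W_M = ∏_{M' matching, M' ≠ M} |σ_M − σ_{M'}|` (`faceRule_of_sharp`).

Chain: `eval_pathDet_exp_eq_zero_iff` (edge normal form: positive roots of `D_m` = real zeros of the matching exponential sum,
p654593) → `exp_newton_gapProduct_index` (ENS gap-product rule, index form, `…ExpNewtonChord`).  Index type = the subsets of the edge
set `{0,…,m−2}` (a subtype), non-matchings inactive.

HONEST FRAMING: a NECESSARY CONDITION for Descartes–Fibonacci sharpness (nobody has a sharp design at `m ≥ 6`; at `m = 5` the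
condition carves the thin region where `B5 = 7` lives — located, memo §2); no register moves (α NO MOVER; B6 ∈ [9, 12]); nothing on
`WeakLifting`/`TropicalB` in their windows, Conjecture B, the doors, `MatrixDescartes` (18050) or `VP ≠ VNP`.
Seat: prover val-sym-lift-p2 g17, `--supports stmt-ValiantsHypothesis-19561`.
-/

set_option linter.dupNamespace false
set_option autoImplicit false

namespace Summit.ValiantsHypothesis.ValiantsHypothesis.Theorems.KPlusLogSqLaw

namespace EdgeNormalForm

open Polynomial Finset
open Summit.ValiantsHypothesis.ValiantsHypothesis.Theorems.KPlusLogSqLaw.StaticTridiagonalRealPotential (pathDet)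
open Summit.ValiantsHypothesis.ValiantsHypothesis.Theorems.LacunarySymmetroidMatrixDescartes.WallBubbling.Bubbling
  (expSum classSum exp_newton_gapProduct_index)

variable (a : ℕ → ℝ) (d : ℕ → ℕ) (b : ℕ → ℝ) (f : ℕ → ℕ)

/-- The coefficient of a subset of edges in the matching exponential sum is nonzero iff the subset is a matching
(all `a_j, b_j ≠ 0`). [this file] -/
theorem coeff_ne_zero_iff (ha : ∀ j, a j ≠ 0) (hb : ∀ j, b j ≠ 0) (M : Finset ℕ) :
    (if (∀ j ∈ M, j + 1 ∉ M) then (-1 : ℝ) ^ M.card * ∏ j ∈ M, b j ^ 2 / (a j * a (j + 1)) else 0) ≠ 0 ↔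
      (∀ j ∈ M, j + 1 ∉ M) := by
  by_cases h : ∀ j ∈ M, j + 1 ∉ M
  · rw [if_pos h]
    refine ⟨fun _ => h, fun _ => ?_⟩
    refine mul_ne_zero (pow_ne_zero _ (by norm_num)) (prod_ne_zero_iff.mpr fun j _ => ?_)
    exact div_ne_zero (pow_ne_zero _ (hb j)) (mul_ne_zero (ha j) (ha (j + 1)))
  · rw [if_neg h]
    exact ⟨fun h0 => absurd rfl h0, fun h' => absurd h' h⟩

/-- **FACE RULE FOR THE α REGISTER (Descartes–Fibonacci sharpness ⇒ gap-product inequalities).**  Design `(a,d,b,f)` with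
`a_j, b_j ≠ 0`; index type `ι = subsets of the edge set {0,…,m−2}`; coefficient `(−1)^{|M|} ∏_{j∈M} b_j²/(a_j a_{j+1})` on matchings,
`0` on non-matchings; exponent `σ_M = ∑_{j∈M} (2f_j − d_j − d_{j+1})`.  If `σ` is injective on the matchings and `D_m` has at least
`#matchings − 1` distinct positive roots, then for matchings `M₀, M₁, M₂, M₃` with `σ M₀ < σ M₁ ≤ σ M₂ < σ M₃`, `σ M₀ + σ M₃ = σ M₁ + σ M₂`
and balanced coefficient moduli, `W M₀ · W M₃ ≤ W M₁ · W M₂` with `W M = ∏_{M' matching ≠ M} |σ M − σ M'|`. [this work] -/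
theorem faceRule_of_sharp (m : ℕ) (ha : ∀ j, a j ≠ 0) (hb : ∀ j, b j ≠ 0)
    (σ : ↥((range (m - 1)).powerset) → ℝ)
    (hσ : σ = fun (M : ↥((range (m - 1)).powerset)) => ∑ j ∈ (M : Finset ℕ), (2 * (f j : ℝ) - d j - d (j + 1)))
    (Act : Finset ↥((range (m - 1)).powerset))
    (hAct : Act = Finset.univ.filter fun (M : ↥((range (m - 1)).powerset)) => ∀ j ∈ (M : Finset ℕ), j + 1 ∉ (M : Finset ℕ))
    (hinj : ∀ M ∈ Act, ∀ M' ∈ Act, σ M = σ M' → M = M')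
    (hsharp : Act.card ≤ (((pathDet a d b f m).roots.toFinset.filter fun x => 0 < x).card) + 1)
    {M₀ M₁ M₂ M₃ : ↥((range (m - 1)).powerset)} (hM₀ : M₀ ∈ Act) (hM₁ : M₁ ∈ Act) (hM₂ : M₂ ∈ Act) (hM₃ : M₃ ∈ Act)
    (h01 : σ M₀ < σ M₁) (h12 : σ M₁ ≤ σ M₂) (h23 : σ M₂ < σ M₃) (hsum : σ M₀ + σ M₃ = σ M₁ + σ M₂)
    (hcoef : (∏ j ∈ (M₀ : Finset ℕ), b j ^ 2 / |a j * a (j + 1)|) * (∏ j ∈ (M₃ : Finset ℕ), b j ^ 2 / |a j * a (j + 1)|) =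
      (∏ j ∈ (M₁ : Finset ℕ), b j ^ 2 / |a j * a (j + 1)|) * (∏ j ∈ (M₂ : Finset ℕ), b j ^ 2 / |a j * a (j + 1)|)) :
    (∏ M' ∈ Act.erase M₀, |σ M₀ - σ M'|) * (∏ M' ∈ Act.erase M₃, |σ M₃ - σ M'|) ≤
      (∏ M' ∈ Act.erase M₁, |σ M₁ - σ M'|) * (∏ M' ∈ Act.erase M₂, |σ M₂ - σ M'|) := by
  classical
  -- the matching exponential sum of the edge normal form
  set A : ↥((range (m - 1)).powerset) → ℝ := fun M => if (∀ j ∈ (M : Finset ℕ), j + 1 ∉ (M : Finset ℕ)) then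
      (-1 : ℝ) ^ (M : Finset ℕ).card * ∏ j ∈ (M : Finset ℕ), b j ^ 2 / (a j * a (j + 1)) else 0 with hAdef
  have hact : ∀ M, A M ≠ 0 ↔ (∀ j ∈ (M : Finset ℕ), j + 1 ∉ (M : Finset ℕ)) := fun M => coeff_ne_zero_iff a b ha hb M
  have hmemAct : ∀ M, M ∈ Act ↔ (∀ j ∈ (M : Finset ℕ), j + 1 ∉ (M : Finset ℕ)) := fun M => by
    rw [hAct]; simp only [Finset.mem_filter, Finset.mem_univ, true_and]
  have hActeq : (Finset.univ.filter fun M => A M ≠ 0) = Act := by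
    ext M; rw [Finset.mem_filter, hmemAct]; simp only [Finset.mem_univ, true_and, hact]
  -- |A M| for a matching
  have habs : ∀ M, M ∈ Act → |A M| = ∏ j ∈ (M : Finset ℕ), b j ^ 2 / |a j * a (j + 1)| := by
    intro M hM
    simp only [hAdef, if_pos ((hmemAct M).mp hM), abs_mul, abs_pow, abs_neg, abs_one, one_pow, one_mul, Finset.abs_prod,
      abs_div]
    refine prod_congr rfl fun j _ => ?_
    rw [sq_abs]
  -- the zeros: logarithms of the positive roots of `D_m`
  set P : Finset ℝ := (pathDet a d b f m).roots.toFinset.filter fun x => 0 < x with hP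
  set Z : Finset ℝ := P.image Real.log with hZdef
  have hZ : ∀ z ∈ Z, expSum A σ z = 0 := by
    intro z hz
    obtain ⟨x, hx, rfl⟩ := Finset.mem_image.mp hz
    have hxpos : 0 < x := (Finset.mem_filter.mp hx).2
    have hroot : (pathDet a d b f m).eval x = 0 := by
      have := (Finset.mem_filter.mp hx).1
      rw [Multiset.mem_toFinset] at this
      exact (Polynomial.mem_roots'.mp this).2
    have key := (eval_pathDet_exp_eq_zero_iff a d b f ha m (Real.log x)).mp (by rwa [Real.exp_log hxpos])
    rw [hσ]
    exact key
  have hcardZ : Z.card = P.card := Finset.card_image_of_injOn fun x hx y hy h =>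
    Real.log_injOn_pos (Finset.mem_filter.mp (Finset.mem_coe.mp hx)).2 (Finset.mem_filter.mp (Finset.mem_coe.mp hy)).2 h
  have hcard : (Finset.univ.filter fun M => A M ≠ 0).card ≤ Z.card + 1 := by
    rw [hActeq, hcardZ]; exact hsharp
  have hinjA : ∀ M M', A M ≠ 0 → A M' ≠ 0 → σ M = σ M' → M = M' := fun M M' hM hM' h =>
    hinj M ((hmemAct M).mpr ((hact M).mp hM)) M' ((hmemAct M').mpr ((hact M').mp hM')) h
  have hA0 : A M₀ ≠ 0 := (hact M₀).mpr ((hmemAct M₀).mp hM₀)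
  have hA1 : A M₁ ≠ 0 := (hact M₁).mpr ((hmemAct M₁).mp hM₁)
  have hA2 : A M₂ ≠ 0 := (hact M₂).mpr ((hmemAct M₂).mp hM₂)
  have hA3 : A M₃ ≠ 0 := (hact M₃).mpr ((hmemAct M₃).mp hM₃)
  have hcoef' : |A M₀| * |A M₃| = |A M₁| * |A M₂| := by
    rw [habs M₀ hM₀, habs M₁ hM₁, habs M₂ hM₂, habs M₃ hM₃]; exact hcoef
  have key := exp_newton_gapProduct_index A σ hinjA Z hZ hcard hA0 hA1 hA2 hA3 h01 h12 h23 hsum hcoef'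
  rw [hActeq] at key
  exact key

end EdgeNormalForm

end Summit.ValiantsHypothesis.ValiantsHypothesis.Theorems.KPlusLogSqLaw
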